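import Summits.MatrixMultiplication.MatrixMultiplication.Theorems.SoloInformedCwTwoCertificates
import Literature.Computability.AlgebraicComplexity.BorderRankCWKoszulRanksSqTwoProofs

/-!
# How deep a certificate for door D1 must sit: level bounds from the kernel window

Solo seat `solo-MatrixMultiplication-informed` (ideation tier, family 6), generation 3, 2026-08-19.

A proof of D1's hypothesis `R̃(T_{cw,2}) ≤ 3` is a family of border-rank certificates
`bR(T_{cw,2}^{⊠n}) ≤ (3+ε)^n` with `ε → 0` (`asymptoticRank_cwTensor_two_le_three_iff_certificates`).
The kernel lower bounds for the powers — `bR(T_{cw,2}) ≥ 4`, `bR(T_{cw,2}^{⊠2}) ≥ 15` (the Literature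
library's proved `le_algBorderRank_cwTensor_two_sq`, Conner–Gesmundo–Landsberg–Ventura Thm. 1.2) and
`3315 · 3^{n−3} ≤ 70 · bR(T_{cw,2}^{⊠n})` for `n ≥ 3` (this seat's certified Koszul bound, i.e.
`bR ≥ 1.7539… · 3^n`) — say quantitatively how deep such certificates must sit:

* `cwTwo_certificate_level` — a certificate with excess `ε` at a level `n ≥ 3` forces
  `3315/1890 ≤ (1 + ε/3)^n ≤ exp(nε/3)`, hence `n · ε ≥ 3 log(3315/1890) = 1.6857…`: the level must grow
  at least like `1.68 / ε` (levels `1, 2` need `ε ≥ 1`, `ε ≥ √15 − 3 = 0.87…` outright);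
* `seven_le_of_cwTwo_certificate` — NO level `n ≤ 6` admits a certificate `bR(T_{cw,2}^{⊠n}) ≤ 3.269^n`.
  Since Coppersmith–Winograd's value bound `ω ≤ log₂(4ρ³/27)` (`ρ > R̃(T_{cw,2})`,
  `omega_le_logb_of_asymptoticRank_cwTensor_lt`) beats the present record `ω < 2.371339` only for
  `ρ < 3.2688` (`log₂(4 · 3.2688³/27) = 2.3714…`; informal numerics, not formalised), the first Kronecker
  power of `T_{cw,2}` whose border rank could still improve `ω` through that bound is the SEVENTH
  (format `2187 × 2187 × 2187`; required `bR ≤ 3.2688^7 < 3990`, kernel lower bound `3836`, trivial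
  upper bound `4^7 = 16384`; no decomposition of any power `n ≥ 3` below `4^n` is known).

References. A. Conner, F. Gesmundo, J. M. Landsberg, E. Ventura, Rank and border rank of Kronecker
powers of tensors and Strassen's laser method, comput. complexity 31 (2022), Thm. 1.2, Prop. 3.2;
D. Coppersmith, S. Winograd, J. Symbolic Comput. 9 (1990), §6 and §11; J. Alman, R. Duan,
V. Vassilevska Williams, Y. Xu, Z. Xu, R. Zhou, More asymmetry yields faster matrix multiplication,
SODA 2025 (`ω < 2.371339`).
-/

noncomputable section

namespace Summit.MatrixMultiplication.MatrixMultiplication.Theorems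

open Literature.Computability.AlgebraicComplexity

/-- The seat's Koszul bound in real form: `3315 · 3^m ≤ 70 · bR(T_{cw,2}^{⊠(m+3)})`.
[cite: ConnerGesmundoLandsbergVentura2022, Prop. 3.2] -/
theorem koszul_bound_kroneckerPow_cwTensor_two_real (m : ℕ) :
    (3315 : ℝ) * 3 ^ m ≤ 70 * (algBorderRank (kroneckerPow (cwTensor ℂ 2) (m + 3)) : ℝ) := by
  have h := CubeP4.le_algBorderRank_kroneckerPow_cwTensor_two_p4 (m + 3) (by omega)
  rw [Nat.add_sub_cancel] at h
  exact_mod_cast h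

/-- **Level versus excess.** A border-rank certificate `bR(T_{cw,2}^{⊠n}) ≤ (3+ε)^n` at a level `n ≥ 3`
forces `3315/1890 ≤ (1 + ε/3)^n`. [cite: ConnerGesmundoLandsbergVentura2022, Thm. 1.2 (iii), Prop. 3.2] -/
theorem cwTwo_certificate_ratio {n : ℕ} (hn : 3 ≤ n) {ε : ℝ}
    (h : (algBorderRank (kroneckerPow (cwTensor ℂ 2) n) : ℝ) ≤ (3 + ε) ^ n) :
    (3315 / 1890 : ℝ) ≤ (1 + ε / 3) ^ n := by
  obtain ⟨m, rfl⟩ : ∃ m, n = m + 3 := ⟨n - 3, by omega⟩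
  have hp := koszul_bound_kroneckerPow_cwTensor_two_real m
  have h1 : (3 + ε) ^ (m + 3) = 27 * 3 ^ m * (1 + ε / 3) ^ (m + 3) := by
    rw [show (3 + ε) = 3 * (1 + ε / 3) by ring, mul_pow, pow_add]; ring
  rw [h1] at h
  have h3m : (0 : ℝ) < 3 ^ m := by positivity
  rw [div_le_iff₀ (by norm_num : (0 : ℝ) < 1890)]
  by_contra hlt
  rw [not_le] at hlt
  have := mul_lt_mul_of_pos_left hlt h3m
  nlinarith

/-- **A certificate with excess `ε` needs level `n ≥ 1.6857/ε`**: `3 · log(3315/1890) ≤ n · ε`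
(`(1 + ε/3)^n ≤ exp(nε/3)`; `3 log(3315/1890) = 1.6857…`). Levels `1` and `2` need `ε ≥ 1` and
`ε ≥ √15 − 3` by `bR(T_{cw,2}) = 4`, `bR(T_{cw,2}^{⊠2}) ≥ 15`.
[cite: ConnerGesmundoLandsbergVentura2022, Thm. 1.2 (iii), Prop. 3.2] -/
theorem cwTwo_certificate_level {n : ℕ} (hn : 3 ≤ n) {ε : ℝ} (hε : 0 ≤ ε)
    (h : (algBorderRank (kroneckerPow (cwTensor ℂ 2) n) : ℝ) ≤ (3 + ε) ^ n) :
    3 * Real.log (3315 / 1890) ≤ n * ε := by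
  have hq := cwTwo_certificate_ratio hn h
  have h2 : (1 + ε / 3) ^ n ≤ Real.exp (n * (ε / 3)) := by
    calc (1 + ε / 3) ^ n ≤ (Real.exp (ε / 3)) ^ n :=
          pow_le_pow_left₀ (by positivity) (by linarith [Real.add_one_le_exp (ε / 3)]) n
      _ = Real.exp (n * (ε / 3)) := by rw [← Real.exp_nat_mul]
  have h3 := Real.log_le_log (by norm_num) (hq.trans h2)
  rw [Real.log_exp] at h3
  linarith

/-- **No certificate below `3.269^n` at any level `n ≤ 6`.** If `bR(T_{cw,2}^{⊠n}) ≤ 3.269^n` with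
`n ≥ 1` then `n ≥ 7` (levels `1, 2`: `bR = 4 > 3.269`, `bR ≥ 15 > 3.269²`; levels `3 – 6`: the Koszul
bound `bR ≥ 1.7539 · 3^n > 3.269^n`). Informally: beating `ω < 2.371339` through Coppersmith–Winograd's
value bound at `T_{cw,2}` needs `ρ < 3.2688`, so the seventh power is the first that could.
[cite: ConnerGesmundoLandsbergVentura2022, Thm. 1.2] [cite: CoppersmithWinograd1990, §6] -/
theorem seven_le_of_cwTwo_certificate {n : ℕ} (hn : 1 ≤ n)
    (h : (algBorderRank (kroneckerPow (cwTensor ℂ 2) n) : ℝ) ≤ (3269 / 1000) ^ n) : 7 ≤ n := by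
  by_contra hlt
  rw [not_le] at hlt
  interval_cases n
  · have h4 : (4 : ℝ) ≤ algBorderRank (kroneckerPow (cwTensor ℂ 2) 1) := by
      exact_mod_cast three_pow_lt_algBorderRank_kroneckerPow_cwTensor_two (n := 1) le_rfl
    norm_num at h
    linarith
  · have h15 : (15 : ℝ) ≤ algBorderRank (kroneckerPow (cwTensor ℂ 2) 2) := by
      exact_mod_cast le_algBorderRank_cwTensor_two_sq
    norm_num at h
    linarith
  · have hp := koszul_bound_kroneckerPow_cwTensor_two_real 0
    norm_num at h hp
    linarith
  · have hp := koszul_bound_kroneckerPow_cwTensor_two_real 1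
    norm_num at h hp
    linarith
  · have hp := koszul_bound_kroneckerPow_cwTensor_two_real 2
    norm_num at h hp
    linarith
  · have hp := koszul_bound_kroneckerPow_cwTensor_two_real 3
    norm_num at h hp
    linarith

/-- The same in asymptotic-rank terms: a Kronecker power of level `n ≤ 6` certifies at best
`R̃(T_{cw,2}) ≤ bR(T_{cw,2}^{⊠n})^{1/n}` with `bR(T_{cw,2}^{⊠n}) > 3.269^n`.
[cite: ConnerGesmundoLandsbergVentura2022, Thm. 1.2] -/
theorem pow_lt_algBorderRank_kroneckerPow_cwTensor_two_of_le_six {n : ℕ} (hn : 1 ≤ n) (h6 : n ≤ 6) :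
    (3269 / 1000 : ℝ) ^ n < (algBorderRank (kroneckerPow (cwTensor ℂ 2) n) : ℝ) := by
  by_contra hle
  rw [not_lt] at hle
  have := seven_le_of_cwTwo_certificate hn hle
  omega

end Summit.MatrixMultiplication.MatrixMultiplication.Theorems

end
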